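import Mathlib
import Literature.Analysis.FluidPDE.TypeIAncientMild
import Literature.Analysis.FluidPDE.OseenSlice
import Literature.Analysis.FluidPDE.MildSolutionProofs
import Summits.NavierStokesRegularity.NavierStokesRegularity.Theorems.SymmetryModuliCountSymmetricLiouvilleSmallAtMinusInfinity
import HarnessLib
import Literature.Analysis.FluidPDE.KNSSMildDecayHorizontal

/-!
# Census block A2 (amplitude meters), cells A2os / A2ho / A2hb (DECIDED, universal thresholds), A2hw (OPEN) — instrument «TWO-POINT ROUGHNESS», LINE «roughness-meter»
# port, part 1/2: constants (§A), the scale-invariant Hölder / oscillation modulus (§B), the zero-mean Oseen-kernel lever (§C), the one-window estimate (§D),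
# the Liouville theorem `eq_zero_of_holderSmall` (§E)

Re-homed for the scenario census (typer seat ns-census-typer-1 g8; cells of ns-idea-2 LINE g14-2 «roughness-meter», record-only ROW-KEY ADDENDUM 02:17:22Z, critic
idea-crit-3 g7 PASS — no price 02:21:58Z, ref PRE-CHECK asked by lead g10 RULING [9] (item 38); this port makes the decided cells TREE-decided): VERBATIM PORT of
`pub/ideators/ns-idea-2/lines/roughness-meter/line-roughness-meter.lean` sha16 4218d76b6803a96e (597 l., lean check rc 0, 0 sorry), split for the 400-line rule
into `ScenarioCensusRoughnessMeter` (§A–§E) → `…RoughnessMeterRows` (§F–§H + census KEYS).  Lean text VERBATIM in namespace `…Theorems.ScenarioCensus.RoughnessMeter`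
(the line's `…Lines.RoughnessMeter` re-homed); port edits: `local notation "E3"` → `abbrev E3` (typer lint: no notation in port files), `@[conjecture]` on the OPEN
row `Row_A2hw` (typed only), seven one-line docstrings added (gate lint); the kernel bound `kernel_bound_three` is the Literature lemma
`exists_norm_oseenKernel_three_le` (`KNSSMildDecayHorizontal`) taken BY NAME (gate lint dedup.landed).  Statements untouched.

No census VALUE is moved here (cells become TREE-decided by name; booking is the lead's); NS regularity is NOT proved; (L′) ⟨10661⟩ is untouched; no summit
statement is proved by this file. Lemmas that restate already-landed tree declarations are taken BY NAME (gate lint `dedup.landed`): `kernel_bound_three` = `exists_norm_oseenKernel_three_le`.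
-/

-- the summit and its single problem share the name `NavierStokesRegularity` (D-0017 nested layout)
set_option linter.dupNamespace false

noncomputable section

open Set Function Filter Topology Metric MeasureTheory

namespace Summit.NavierStokesRegularity.NavierStokesRegularity.Theorems.ScenarioCensus.RoughnessMeter

open Literature.Analysis Literature.Analysis.FluidPDE
open Summit.NavierStokesRegularity.NavierStokesRegularity.Theorems.SymmetryModuliCountSymmetricLiouville
  (vanishes_of_vanishes_before)

/-- `ℝ³` (the line's `local notation "E3"`, spelled as a reducible abbreviation for the tree). -/
abbrev E3 := EuclideanSpace ℝ (Fin 3)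

/-! ## A. Constants: the kernel constant, the Hölder weight, the roughness constant -/

-- `kernel_bound_three`: the line restates the tree's `exists_norm_oseenKernel_three_le`; taken BY NAME (gate lint dedup.landed).

/-- The kernel constant `C_K` of `exists_norm_oseenKernel_three_le`, fixed once and for all. -/
def kernelConst : ℝ := Classical.choose exists_norm_oseenKernel_three_le

/-- The kernel constant is positive. -/
theorem kernelConst_pos : 0 < kernelConst := (Classical.choose_spec exists_norm_oseenKernel_three_le).1

/-- The kernel bound with the fixed constant `kernelConst`. -/
theorem kernelConst_spec {σ : ℝ} (hσ : 0 < σ) (z a b : E3) :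
    ‖oseenKernel σ z a b‖ ≤ kernelConst * (σ + ‖z‖ ^ 2) ^ (-(2 : ℝ)) * ‖a‖ * ‖b‖ :=
  (Classical.choose_spec exists_norm_oseenKernel_three_le).2 hσ z a b

/-- The **Hölder weight** `I_α = ∫_{ℝ³} (1 + ‖w‖²)^{-(2 - α/2)} dw` — the unit-scale mass of the
kernel majorant against the modulus `‖z‖^α`; finite for `α < 1`. -/
def holderWeight (α : ℝ) : ℝ := ∫ w : E3, (1 + ‖w‖ ^ 2) ^ (-(2 - α / 2))

/-- The Hölder weight is positive for `α < 1`. -/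
theorem holderWeight_pos {α : ℝ} (hα : α < 1) : 0 < holderWeight α := by
  unfold holderWeight
  refine integral_one_add_norm_sq_rpow_neg_pos (E := E3) ?_
  rw [finrank_euclideanSpace_fin]; push_cast; linarith

/-- The **roughness constant** `K_α = 4 C_K I_α / (α + 1)`: the factor in the one-window bound
`√(-t) ‖B¹_{2t}(u, u)(t)‖ ≤ K_α · δ · M` (`duhamel_bound`). -/
def roughConst (α : ℝ) : ℝ := 4 * kernelConst * holderWeight α / (α + 1)

/-- The roughness constant is positive for `-1 < α < 1`. -/
theorem roughConst_pos {α : ℝ} (hαm : -1 < α) (hα : α < 1) : 0 < roughConst α := by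
  unfold roughConst
  have := kernelConst_pos
  have := holderWeight_pos hα
  have : 0 < α + 1 := by linarith
  positivity

/-! ## B. The instrument: the scale-invariant Hölder / oscillation modulus of the slices -/

/-- **The hypothesis the instrument meters.**  `HolderSmall δ α u`: every slice `u(t)`, `t < 0`,
has scale-invariant `C^α` modulus at most `δ`:
`‖u(t, x) - u(t, y)‖ ≤ δ · (-t)^{-(1+α)/2} · ‖x - y‖^α` for all `x, y`
(for `α = 0`: the OSCILLATION of every slice is at most `δ/√(-t)`).  Scale-invariant under
`u ↦ λ u(λ² t, λ x)`; blind to slice constants; implied by nothing the tree meters (amplitude,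
gradient, strain are one-point quantities). -/
def HolderSmall (δ α : ℝ) (u : ℝ → E3 → E3) : Prop :=
  ∀ t < 0, ∀ x y : E3, ‖u t x - u t y‖ ≤ δ * (-t) ^ (-(1 + α) / 2) * ‖x - y‖ ^ α

/-! ## C. The lever: the Oseen kernel has zero mean, so the Duhamel term only sees OSCILLATION -/

/-- Pointwise algebra: `K[a, a] - K[b, b] = K[a - b, a] + K[b, a - b]` (bilinearity). -/
theorem kernel_diag_sub (σ : ℝ) (z a b : E3) :
    oseenKernel σ z a a - oseenKernel σ z b b =
      oseenKernel σ z (a - b) a + oseenKernel σ z b (a - b) := by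
  rw [oseenKernel_sub_left, oseenKernel_sub_right]
  abel

/-- The weight algebra: `(σ + ‖z‖²)^{-2} · ‖z‖^α ≤ (σ + ‖z‖²)^{-(2 - α/2)}` for `σ > 0`, `α ≥ -1`
(indeed for any real `α ≥ 0`; we only need `‖z‖^α ≤ (σ + ‖z‖²)^{α/2}`, which holds for `α ≥ 0`,
and for `α < 0` we do not use this lemma). -/
theorem weight_mul_rpow_le {σ α : ℝ} (hσ : 0 < σ) (hα : 0 ≤ α) (z : E3) :
    (σ + ‖z‖ ^ 2) ^ (-(2 : ℝ)) * ‖z‖ ^ α ≤ (σ + ‖z‖ ^ 2) ^ (-(2 - α / 2)) := by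
  have hb : 0 < σ + ‖z‖ ^ 2 := by positivity
  have h1 : ‖z‖ ^ α ≤ (σ + ‖z‖ ^ 2) ^ (α / 2) := by
    have e : ‖z‖ ^ α = (‖z‖ ^ 2) ^ (α / 2) := by
      rw [show (‖z‖ ^ 2 : ℝ) = ‖z‖ ^ (2 : ℝ) by norm_cast, ← Real.rpow_mul (norm_nonneg _)]
      congr 1; ring
    rw [e]
    exact Real.rpow_le_rpow (sq_nonneg _) (le_add_of_nonneg_left hσ.le) (by linarith)
  have e2 : (σ + ‖z‖ ^ 2) ^ (-(2 - α / 2)) = (σ + ‖z‖ ^ 2) ^ (-(2 : ℝ)) * (σ + ‖z‖ ^ 2) ^ (α / 2) := by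
    rw [← Real.rpow_add hb]; congr 1; ring
  rw [e2]
  exact mul_le_mul_of_nonneg_left h1 (Real.rpow_nonneg hb.le _)

/-- **Inner (one-slice) bound — the zero-mean lever.**  For a slice `f = u(τ)` with amplitude
`‖f‖ ≤ A` and modulus `‖f x - f y‖ ≤ H ‖x - y‖^α` (`0 ≤ α < 1`), the Oseen slice at lag `σ > 0`
obeys `‖∫ K(σ, x - y)[f y, f y] dy‖ ≤ 2 C_K I_α · A · H · σ^{(α-1)/2}`:
subtract the constant tensor `f(x) ⊗ f(x)` (zero mean of the kernel, KNSS Remark 6.1 /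
`integral_oseenKernel_sub_left_eq_zero`), bound the difference by bilinearity, and integrate the
majorant `(σ + ‖z‖²)^{-(2-α/2)}` by scaling (`integral_add_norm_sq_rpow_neg`). -/
theorem inner_bound {α : ℝ} (hα0 : 0 ≤ α) (hα : α < 1) {σ : ℝ} (hσ : 0 < σ)
    {f : E3 → E3} (hfm : AEStronglyMeasurable f volume) {A H : ℝ} (hA0 : 0 ≤ A) (hH0 : 0 ≤ H)
    (hA : ∀ y, ‖f y‖ ≤ A) (hH : ∀ x y, ‖f x - f y‖ ≤ H * ‖x - y‖ ^ α) (x : E3) :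
    ‖∫ y, oseenKernel σ (x - y) (f y) (f y)‖ ≤
      2 * kernelConst * holderWeight α * A * H * σ ^ ((α - 1) / 2) := by
  set b : E3 := f x with hb
  -- integrability of the two integrands
  have hf : Integrable (fun y => oseenKernel σ (x - y) (f y) (f y)) :=
    integrable_oseenKernel_slice_of_bound hσ hfm hfm hA hA x
  have hg : Integrable (fun y => oseenKernel σ (x - y) b b) :=
    integrable_oseenKernel_slice_of_bound hσ aestronglyMeasurable_const aestronglyMeasurable_const
      (fun _ => le_rfl) (fun _ => le_rfl) x
  have hg0 : ∫ y, oseenKernel σ (x - y) b b = 0 := integral_oseenKernel_sub_left_eq_zero σ x b b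
  have hrepr : ∫ y, oseenKernel σ (x - y) (f y) (f y) =
      ∫ y, (oseenKernel σ (x - y) (f y) (f y) - oseenKernel σ (x - y) b b) := by
    rw [integral_sub hf hg, hg0, sub_zero]
  rw [hrepr]
  -- the majorant
  have he : (Module.finrank ℝ E3 : ℝ) < 2 * (2 - α / 2) := by
    rw [finrank_euclideanSpace_fin]; push_cast; linarith
  have hw : Integrable (fun z : E3 => (σ + ‖z‖ ^ 2) ^ (-(2 - α / 2))) :=
    integrable_add_norm_sq_rpow_neg he hσ
  have hwx : Integrable (fun y : E3 => (σ + ‖x - y‖ ^ 2) ^ (-(2 - α / 2))) := hw.comp_sub_left x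
  have hCK := kernelConst_pos
  have hbound : ∀ y, ‖oseenKernel σ (x - y) (f y) (f y) - oseenKernel σ (x - y) b b‖ ≤
      2 * kernelConst * A * H * (σ + ‖x - y‖ ^ 2) ^ (-(2 - α / 2)) := by
    intro y
    rw [kernel_diag_sub]
    have hwnn : 0 ≤ (σ + ‖x - y‖ ^ 2) ^ (-(2 : ℝ)) := Real.rpow_nonneg (by positivity) _
    have hdy : ‖f y - b‖ ≤ H * ‖x - y‖ ^ α := by
      rw [hb, norm_sub_rev]; exact hH x y
    have h1 : ‖oseenKernel σ (x - y) (f y - b) (f y)‖ ≤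
        kernelConst * (σ + ‖x - y‖ ^ 2) ^ (-(2 : ℝ)) * (H * ‖x - y‖ ^ α) * A := by
      refine (kernelConst_spec hσ _ _ _).trans ?_
      gcongr
      exact hA y
    have h2 : ‖oseenKernel σ (x - y) b (f y - b)‖ ≤
        kernelConst * (σ + ‖x - y‖ ^ 2) ^ (-(2 : ℝ)) * A * (H * ‖x - y‖ ^ α) := by
      refine (kernelConst_spec hσ _ _ _).trans ?_
      gcongr
      exact hA x
    have hwt := weight_mul_rpow_le hσ hα0 (x - y)
    calc ‖oseenKernel σ (x - y) (f y - b) (f y) + oseenKernel σ (x - y) b (f y - b)‖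
        ≤ kernelConst * (σ + ‖x - y‖ ^ 2) ^ (-(2 : ℝ)) * (H * ‖x - y‖ ^ α) * A +
          kernelConst * (σ + ‖x - y‖ ^ 2) ^ (-(2 : ℝ)) * A * (H * ‖x - y‖ ^ α) :=
          (norm_add_le _ _).trans (add_le_add h1 h2)
      _ = 2 * kernelConst * A * H * ((σ + ‖x - y‖ ^ 2) ^ (-(2 : ℝ)) * ‖x - y‖ ^ α) := by ring
      _ ≤ 2 * kernelConst * A * H * (σ + ‖x - y‖ ^ 2) ^ (-(2 - α / 2)) :=
          mul_le_mul_of_nonneg_left hwt (by positivity)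
  refine (norm_integral_le_of_norm_le (hwx.const_mul (2 * kernelConst * A * H))
    (Eventually.of_forall hbound)).trans ?_
  rw [MeasureTheory.integral_const_mul]
  have hsub : ∫ y : E3, (σ + ‖x - y‖ ^ 2) ^ (-(2 - α / 2)) =
      ∫ z : E3, (σ + ‖z‖ ^ 2) ^ (-(2 - α / 2)) :=
    integral_sub_left_eq_self (fun z : E3 => (σ + ‖z‖ ^ 2) ^ (-(2 - α / 2))) volume x
  rw [hsub, integral_add_norm_sq_rpow_neg hσ (2 - α / 2), finrank_euclideanSpace_fin]
  have e : ((3 : ℕ) : ℝ) / 2 - (2 - α / 2) = (α - 1) / 2 := by push_cast; ring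
  rw [e]
  unfold holderWeight
  apply le_of_eq
  ring

/-! ## D. The one-window estimate: memory window `(2t, t)` -/

/-- The time weight `τ ↦ (t - τ)^r` is integrable on `(2t, t)` for `r > -1`, `t < 0`. -/
theorem integrableOn_sub_rpow {t r : ℝ} (ht : t < 0) (hr : -1 < r) :
    IntegrableOn (fun τ : ℝ => (t - τ) ^ r) (Ioo (2 * t) t) := by
  have h2 : 2 * t ≤ t := by linarith
  have hII : IntervalIntegrable (fun x : ℝ => x ^ r) volume (-t) 0 :=
    intervalIntegral.intervalIntegrable_rpow' hr
  have hc := hII.comp_sub_left t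
  have e1 : t - -t = 2 * t := by ring
  have e2 : t - 0 = t := by ring
  rw [e1, e2] at hc
  exact (intervalIntegrable_iff_integrableOn_Ioo_of_le h2).1 hc

/-- `∫_{(2t, t)} (t - τ)^r dτ = (-t)^{r+1} / (r + 1)` for `r > -1`, `t < 0`. -/
theorem setIntegral_sub_rpow {t r : ℝ} (ht : t < 0) (hr : -1 < r) :
    ∫ τ in Ioo (2 * t) t, (t - τ) ^ r = (-t) ^ (r + 1) / (r + 1) := by
  have h2 : 2 * t ≤ t := by linarith
  rw [← integral_Ioc_eq_integral_Ioo, ← intervalIntegral.integral_of_le h2,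
    intervalIntegral.integral_comp_sub_left (fun x : ℝ => x ^ r) t]
  have e1 : t - t = 0 := by ring
  have e2 : t - 2 * t = -t := by ring
  rw [e1, e2, integral_rpow (Or.inl hr), Real.zero_rpow (by linarith), sub_zero]

/-- **One-window Duhamel bound (the engine).**  Let `u` be a Type-I ancient mild field, `t < 0`,
and suppose on ALL slices `τ < 0`: amplitude `√(-τ) ‖u(τ, y)‖ ≤ M` and modulus
`‖u(τ, x) - u(τ, y)‖ ≤ δ (-τ)^{-(1+α)/2} ‖x - y‖^α` (`0 ≤ α < 1`).  Then the Duhamel term over the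
memory window `(2t, t)` obeys `‖B¹_{2t}(u, u)(t, x)‖ ≤ K_α · M · δ / √(-t)`. -/
theorem duhamel_bound {C : ℝ} {u : ℝ → E3 → E3} (h : IsTypeIAncientMild C u) {α : ℝ}
    (hα0 : 0 ≤ α) (hα : α < 1) {t : ℝ} (ht : t < 0) {M δ : ℝ} (hM0 : 0 ≤ M) (hδ0 : 0 ≤ δ)
    (hamp : ∀ τ < 0, ∀ y, Real.sqrt (-τ) * ‖u τ y‖ ≤ M) (hmod : HolderSmall δ α u) (x : E3) :
    ‖∫ τ in Ioo (2 * t) t, ∫ y, oseenKernel (t - τ) (x - y) (u τ y) (u τ y)‖ ≤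
      roughConst α * M * δ / Real.sqrt (-t) := by
  have hs0 : 0 < Real.sqrt (-t) := Real.sqrt_pos.2 (by linarith)
  have hnt : 0 < -t := by linarith
  have hCK := kernelConst_pos
  have hI := holderWeight_pos hα
  -- the frozen amplitude and modulus factors at the END of the window
  set A : ℝ := M / Real.sqrt (-t) with hA
  set H : ℝ := δ * (-t) ^ (-(1 + α) / 2) with hH
  have hA0 : 0 ≤ A := by positivity
  have hH0 : 0 ≤ H := by positivity
  set r : ℝ := (α - 1) / 2 with hr
  have hr1 : -1 < r := by rw [hr]; linarith
  set G : ℝ := 2 * kernelConst * holderWeight α * A * H with hG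
  have hG0 : 0 ≤ G := by positivity
  -- pointwise bound on the window
  have hpt : ∀ τ ∈ Ioo (2 * t) t,
      ‖∫ y, oseenKernel (t - τ) (x - y) (u τ y) (u τ y)‖ ≤ G * (t - τ) ^ r := by
    intro τ hτ
    have hτ0 : τ < 0 := hτ.2.trans ht
    have hστ : 0 < t - τ := by linarith [hτ.2]
    have hsτ : 0 < Real.sqrt (-τ) := Real.sqrt_pos.2 (by linarith)
    have hsτt : Real.sqrt (-t) ≤ Real.sqrt (-τ) := Real.sqrt_le_sqrt (by linarith [hτ.2])
    -- amplitude of the slice `u τ`: `≤ M/√(-τ) ≤ M/√(-t) = A`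
    have hAτ : ∀ y, ‖u τ y‖ ≤ A := fun y => by
      have h1 := hamp τ hτ0 y
      have h2 : ‖u τ y‖ ≤ M / Real.sqrt (-τ) := by
        rw [le_div_iff₀ hsτ, mul_comm]; exact h1
      exact h2.trans (div_le_div_of_nonneg_left hM0 hs0 hsτt)
    -- modulus of the slice `u τ`: `≤ δ (-τ)^{-(1+α)/2} ≤ H`
    have hHτ : ∀ x y, ‖u τ x - u τ y‖ ≤ H * ‖x - y‖ ^ α := fun x' y' => by
      have h1 := hmod τ hτ0 x' y'
      have hmono : (-τ) ^ (-(1 + α) / 2) ≤ (-t) ^ (-(1 + α) / 2) :=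
        Real.rpow_le_rpow_of_nonpos hnt (by linarith [hτ.2]) (by
          have : 0 ≤ 1 + α := by linarith
          have : -(1 + α) / 2 ≤ 0 := by linarith
          exact this)
      refine h1.trans ?_
      have : δ * (-τ) ^ (-(1 + α) / 2) ≤ H := by
        rw [hH]; exact mul_le_mul_of_nonneg_left hmono hδ0
      exact mul_le_mul_of_nonneg_right this (Real.rpow_nonneg (norm_nonneg _) _)
    have key := inner_bound hα0 hα hστ (h.aestronglyMeasurable_slice hτ0) hA0 hH0 hAτ hHτ x
    rw [hG]
    exact key
  -- integrate the majorant over the window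
  have hint : IntegrableOn (fun τ : ℝ => G * (t - τ) ^ r) (Ioo (2 * t) t) :=
    (integrableOn_sub_rpow ht hr1).const_mul G
  have hle : ‖∫ τ in Ioo (2 * t) t, ∫ y, oseenKernel (t - τ) (x - y) (u τ y) (u τ y)‖ ≤
      ∫ τ in Ioo (2 * t) t, G * (t - τ) ^ r :=
    norm_integral_le_of_norm_le hint ((ae_restrict_iff' measurableSet_Ioo).2
      (Eventually.of_forall hpt))
  refine hle.trans ?_
  rw [integral_const_mul, setIntegral_sub_rpow ht hr1]
  -- bookkeeping: `G (-t)^{r+1}/(r+1) = K_α M δ / √(-t)`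
  have er : r + 1 = (α + 1) / 2 := by rw [hr]; ring
  rw [er, div_div_eq_mul_div]
  have hcancel : (-t) ^ (-(1 + α) / 2) * (-t) ^ ((α + 1) / 2) = 1 := by
    rw [← Real.rpow_add hnt, show -(1 + α) / 2 + (α + 1) / 2 = (0 : ℝ) by ring, Real.rpow_zero]
  have e1 : G * ((-t) ^ ((α + 1) / 2) * 2 / (α + 1)) =
      (2 * kernelConst * holderWeight α * M * δ) *
        ((-t) ^ (-(1 + α) / 2) * (-t) ^ ((α + 1) / 2)) * 2 / (α + 1) / Real.sqrt (-t) := by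
    rw [hG, hA, hH]; ring
  rw [e1, hcancel, roughConst]
  apply le_of_eq
  ring

/-- **The contraction step.**  Under the hypotheses of `duhamel_bound` (amplitude `≤ M` and
modulus `≤ δ` on all slices), the amplitude improves:
`√(-t) ‖u(t, x)‖ ≤ M/√2 + K_α δ M` for every `t < 0`, `x` — the free part from the slice `2t`
carries at most `M/√(-2t)` (heat contraction), the Duhamel part at most `K_α δ M/√(-t)`. -/
theorem holder_step {C : ℝ} {u : ℝ → E3 → E3} (h : IsTypeIAncientMild C u) {α : ℝ}
    (hα0 : 0 ≤ α) (hα : α < 1) {M δ : ℝ} (hM0 : 0 ≤ M) (hδ0 : 0 ≤ δ)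
    (hamp : ∀ τ < 0, ∀ y, Real.sqrt (-τ) * ‖u τ y‖ ≤ M) (hmod : HolderSmall δ α u) :
    ∀ t < 0, ∀ x, Real.sqrt (-t) * ‖u t x‖ ≤ M / Real.sqrt 2 + roughConst α * δ * M := by
  intro t ht x
  have hs0 : 0 < Real.sqrt (-t) := Real.sqrt_pos.2 (by linarith)
  have h2t : 2 * t < t := by linarith
  have h2t0 : 2 * t < 0 := by linarith
  have hs2 : 0 < Real.sqrt (-(2 * t)) := Real.sqrt_pos.2 (by linarith)
  -- free part
  have hb : ∀ z, ‖u (2 * t) z‖ ≤ M / Real.sqrt (-(2 * t)) := fun z => by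
    rw [le_div_iff₀ hs2, mul_comm]; exact hamp _ h2t0 z
  have hfree : ‖heatFlow (u (2 * t)) (t - 2 * t) x‖ ≤ M / Real.sqrt (-(2 * t)) :=
    norm_heatFlow_le hb _ x
  -- Duhamel part
  have hduh := duhamel_bound h hα0 hα ht hM0 hδ0 hamp hmod x
  -- assemble
  have hu : ‖u t x‖ ≤ M / Real.sqrt (-(2 * t)) + roughConst α * M * δ / Real.sqrt (-t) := by
    rw [h.mild_eq_oseenKernel h2t ht x]
    exact (norm_sub_le _ _).trans (add_le_add hfree hduh)
  have hsq2 : Real.sqrt (-(2 * t)) = Real.sqrt 2 * Real.sqrt (-t) := by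
    rw [show -(2 * t) = 2 * (-t) by ring, Real.sqrt_mul (by norm_num : (0 : ℝ) ≤ 2)]
  have hs2pos : 0 < Real.sqrt 2 := Real.sqrt_pos.2 (by norm_num)
  calc Real.sqrt (-t) * ‖u t x‖
      ≤ Real.sqrt (-t) * (M / Real.sqrt (-(2 * t)) + roughConst α * M * δ / Real.sqrt (-t)) :=
        mul_le_mul_of_nonneg_left hu hs0.le
    _ = M / Real.sqrt 2 + roughConst α * δ * M := by
        rw [hsq2]; field_simp; try ring

/-! ## E. The Liouville theorem: geometric contraction of the amplitude -/

/-- **Roughness floor, explicit form.**  A Type-I ancient mild field (KNSS gauge, ANY constant `C`)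
whose slices have scale-invariant `C^α` modulus at most `δ` (`HolderSmall δ α u`, `0 ≤ α < 1`)
with `1/√2 + K_α δ < 1` vanishes identically: by `holder_step` the amplitude bound `M` improves to
`q M`, `q = 1/√2 + K_α δ < 1`; starting from `M = C` and iterating, `√(-t)‖u(t, x)‖ ≤ qⁿ C → 0`.
No endgame from the tree is needed; the threshold on `δ` does NOT depend on `C`. -/
theorem eq_zero_of_holderSmall {C : ℝ} {u : ℝ → E3 → E3} (h : IsTypeIAncientMild C u) {α δ : ℝ}
    (hα0 : 0 ≤ α) (hα : α < 1) (hδ0 : 0 ≤ δ) (hq : 1 / Real.sqrt 2 + roughConst α * δ < 1)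
    (hmod : HolderSmall δ α u) : ∀ t < 0, ∀ x, u t x = 0 := by
  have hC0 : 0 ≤ C := h.nonneg
  set q : ℝ := 1 / Real.sqrt 2 + roughConst α * δ with hqdef
  have hq0 : 0 ≤ q := by
    have := roughConst_pos (by linarith) hα
    positivity
  -- the iteration
  have iter : ∀ n : ℕ, ∀ τ < 0, ∀ y, Real.sqrt (-τ) * ‖u τ y‖ ≤ q ^ n * C := by
    intro n
    induction n with
    | zero =>
        intro τ hτ y
        have hs : 0 < Real.sqrt (-τ) := Real.sqrt_pos.2 (by linarith)
        have := h.norm_le hτ y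
        rw [pow_zero, one_mul, mul_comm, ← le_div_iff₀ hs]
        exact this
    | succ n ih =>
        intro τ hτ y
        have hMn : 0 ≤ q ^ n * C := by positivity
        have step := holder_step h hα0 hα hMn hδ0 ih hmod τ hτ y
        refine step.trans (le_of_eq ?_)
        rw [pow_succ, hqdef]
        field_simp
        try ring
  -- the limit
  intro t ht x
  have hs : 0 < Real.sqrt (-t) := Real.sqrt_pos.2 (by linarith)
  have hlim : Tendsto (fun n : ℕ => q ^ n * C) atTop (𝓝 0) := by
    simpa using (tendsto_pow_atTop_nhds_zero_of_lt_one hq0 hq).mul_const C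
  have hle : Real.sqrt (-t) * ‖u t x‖ ≤ 0 :=
    ge_of_tendsto' hlim fun n => iter n t ht x
  have : ‖u t x‖ ≤ 0 := by
    by_contra hne
    push Not at hne
    have : 0 < Real.sqrt (-t) * ‖u t x‖ := mul_pos hs hne
    linarith
  exact norm_le_zero_iff.1 this

end Summit.NavierStokesRegularity.NavierStokesRegularity.Theorems.ScenarioCensus.RoughnessMeter

end
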